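import Mathlib
import Summits.SmoothPoincare4.SmoothPoincare4.Theorems.InformationMetricHadamardYamabePinchedEinsteinBulkStubBishopDefect

/-!
# Crux `YamabePinchedEinsteinBulk` (stmt-SmoothPoincare4-7996), line `Sketch`: the Bishop-defect
budget inequality (helper `helper_defectBudget`)

The quantitative heart of card `tracefree-riccati-defect`: along a ray, the Bishop–Gromov density
defect `D = 4 coth t − tr 𝒰` of a solution of the Einstein Riccati equation `𝒰' = 1 − 𝒲 − 𝒰²`
(`tr 𝒲 = 0`) is a Lyapunov function for the trace-free shape operator: from the landed identity
`D' = tr((𝒰°)²) − D (4 coth t + tr 𝒰)/4` (`stub_bishopDefect`) and Bishop's inequality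
`tr 𝒰 ≤ 4 coth t` (i.e. `D ≥ 0`), for every `C¹` window `η` on `[t₁, t₂] ⊂ (0, ∞)` vanishing at
the end points with `0 ≤ η ≤ 1`, `|η'| ≤ C`:

  `∫_{t₁}^{t₂} η tr((𝒰°)²) dt ≤ (C + 2 coth t₁) ∫_{t₁}^{t₂} D dt`

(integrate `η D'` by parts; bound `η D (4 coth t + tr 𝒰)/4 ≤ 2 coth t₁ · D`). So the total defect
`∫ D` (the per-ray volume budget) pays for the windowed `L²` norm of `𝒰°`.

* `coth_le_coth` — `coth` is nonincreasing on `(0, ∞)`;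
* `helper_defectBudget` — the registered helper.
Everything is proved (kind = proof); no definitions.
-/

noncomputable section

-- the prescribed namespace `Summit.<P>.<Sub>.…` duplicates `SmoothPoincare4` (P = Sub)
set_option linter.dupNamespace false

open Set MeasureTheory intervalIntegral

namespace Summit.SmoothPoincare4.SmoothPoincare4.Cruxes.YamabePinchedEinsteinBulk.Sketch

/-- `coth t = cosh t / sinh t` is nonincreasing on `(0, ∞)`:
`cosh t sinh t₁ ≤ cosh t₁ sinh t` is `0 ≤ sinh (t − t₁)`. [folklore] -/
theorem coth_le_coth {t₁ t : ℝ} (h₁ : 0 < t₁) (h : t₁ ≤ t) :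
    Real.cosh t / Real.sinh t ≤ Real.cosh t₁ / Real.sinh t₁ := by
  have hs : 0 < Real.sinh t := Real.sinh_pos_iff.2 (h₁.trans_le h)
  have hs₁ : 0 < Real.sinh t₁ := Real.sinh_pos_iff.2 h₁
  rw [div_le_div_iff₀ hs hs₁]
  have hsub := Real.sinh_sub t t₁
  have hnn : 0 ≤ Real.sinh (t - t₁) := Real.sinh_nonneg_iff.2 (sub_nonneg.2 h)
  nlinarith [hsub, hnn]

/-- **The Bishop-defect budget inequality (registered helper `helper_defectBudget` of line
`Sketch`).** Let `𝒰` solve `𝒰' = 1 − 𝒲(t) − 𝒰²` on `[t₁, t₂]`, `0 < t₁`, with `tr 𝒲 = 0`,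
and suppose Bishop's inequality `tr 𝒰 ≤ 4 coth t` there. Then for every window `η`,
`C¹` on `[t₁, t₂]` with continuous derivative `η'`, `η(t₁) = η(t₂) = 0`, `0 ≤ η ≤ 1`, `|η'| ≤ C`:
`∫_{t₁}^{t₂} η · tr((𝒰 − (tr 𝒰/4) I)²) ≤ (C + 2 coth t₁) · ∫_{t₁}^{t₂} (4 coth t − tr 𝒰)`.
[folklore] -/
theorem helper_defectBudget :
    ∀ (U W : ℝ → Matrix (Fin 4) (Fin 4) ℝ) (η η' : ℝ → ℝ) (t₁ t₂ C : ℝ), 0 < t₁ → t₁ ≤ t₂ →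
      (∀ t ∈ Set.Icc t₁ t₂, HasDerivAt U (-(-1 + W t) - U t * U t) t) →
      (∀ t ∈ Set.Icc t₁ t₂, (W t).trace = 0) →
      (∀ t ∈ Set.Icc t₁ t₂, HasDerivAt η (η' t) t) → ContinuousOn η' (Set.Icc t₁ t₂) →
      η t₁ = 0 → η t₂ = 0 →
      (∀ t ∈ Set.Icc t₁ t₂, 0 ≤ η t) → (∀ t ∈ Set.Icc t₁ t₂, η t ≤ 1) →
      (∀ t ∈ Set.Icc t₁ t₂, |η' t| ≤ C) →
      (∀ t ∈ Set.Icc t₁ t₂, (U t).trace ≤ 4 * (Real.cosh t / Real.sinh t)) →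
      ∫ t in t₁..t₂, η t *
          ((U t - ((U t).trace / 4) • (1 : Matrix (Fin 4) (Fin 4) ℝ)) *
            (U t - ((U t).trace / 4) • (1 : Matrix (Fin 4) (Fin 4) ℝ))).trace ≤
        (C + 2 * (Real.cosh t₁ / Real.sinh t₁)) *
          ∫ t in t₁..t₂, (4 * (Real.cosh t / Real.sinh t) - (U t).trace) := by
  intro U W η η' t₁ t₂ C ht₁ ht hU hW hη hη'c hη₁ hη₂ hη0 hη1 hC hBG
  -- abbreviations
  set coth : ℝ → ℝ := fun t => Real.cosh t / Real.sinh t with hcoth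
  set H : ℝ → ℝ := fun t => (U t).trace with hH
  set Q : ℝ → ℝ := fun t =>
    ((U t - ((U t).trace / 4) • (1 : Matrix (Fin 4) (Fin 4) ℝ)) *
      (U t - ((U t).trace / 4) • (1 : Matrix (Fin 4) (Fin 4) ℝ))).trace with hQ
  set D : ℝ → ℝ := fun t => 4 * coth t - H t with hD
  set D' : ℝ → ℝ := fun t => Q t - D t * (4 * coth t + H t) / 4 with hD'
  have hpos : ∀ t ∈ Icc t₁ t₂, 0 < t := fun t ht' => ht₁.trans_le ht'.1
  have hsinh : ∀ t ∈ Icc t₁ t₂, Real.sinh t ≠ 0 := fun t ht' =>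
    (Real.sinh_pos_iff.2 (hpos t ht')).ne'
  -- the landed identity `D' = tr((𝒰°)²) − D(4 coth t + H)/4`
  have hDd : ∀ t ∈ Icc t₁ t₂, HasDerivAt D (D' t) t := fun t ht' =>
    stub_bishopDefect U W t (hpos t ht') (hU t ht') (hW t ht')
  -- continuity on the window
  have hUc : ContinuousOn U (Icc t₁ t₂) := by
    -- continuity needs a normed structure on the matrices: Mathlib's scoped `L∞` operator norm
    -- (its topology is the product topology of the statement, definitionally)
    open scoped Matrix.Norms.Operator in
    exact fun t ht' => (hU t ht').continuousAt.continuousWithinAt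
  have hcothc : ContinuousOn coth (Icc t₁ t₂) :=
    Real.continuous_cosh.continuousOn.div Real.continuous_sinh.continuousOn hsinh
  have hHc : ContinuousOn H (Icc t₁ t₂) :=
    (continuous_id.matrix_trace :
      Continuous fun M : Matrix (Fin 4) (Fin 4) ℝ => M.trace).comp_continuousOn hUc
  have hQc : ContinuousOn Q (Icc t₁ t₂) := by
    have h1 : Continuous fun M : Matrix (Fin 4) (Fin 4) ℝ =>
        M - (M.trace / 4) • (1 : Matrix (Fin 4) (Fin 4) ℝ) :=
      continuous_id.sub ((continuous_id.matrix_trace.div_const 4).smul continuous_const)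
    have hφ : Continuous fun M : Matrix (Fin 4) (Fin 4) ℝ =>
        ((M - (M.trace / 4) • (1 : Matrix (Fin 4) (Fin 4) ℝ)) *
          (M - (M.trace / 4) • (1 : Matrix (Fin 4) (Fin 4) ℝ))).trace :=
      (h1.matrix_mul h1).matrix_trace
    exact hφ.comp_continuousOn hUc
  have hDc : ContinuousOn D (Icc t₁ t₂) := (continuousOn_const.mul hcothc).sub hHc
  have hD'c : ContinuousOn D' (Icc t₁ t₂) :=
    hQc.sub ((hDc.mul ((continuousOn_const.mul hcothc).add hHc)).div_const 4)
  have hηc : ContinuousOn η (Icc t₁ t₂) := fun t ht' =>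
    (hη t ht').continuousAt.continuousWithinAt
  -- interval integrability of everything in sight
  have hII : ∀ {f : ℝ → ℝ}, ContinuousOn f (Icc t₁ t₂) → IntervalIntegrable f volume t₁ t₂ :=
    fun hf => ContinuousOn.intervalIntegrable (by rwa [uIcc_of_le ht])
  -- integration by parts: `∫ η D' = −∫ η' D`
  have hparts : ∫ t in t₁..t₂, η t * D' t = -∫ t in t₁..t₂, η' t * D t := by
    have h := intervalIntegral.integral_mul_deriv_eq_deriv_mul (a := t₁) (b := t₂)
      (u := η) (v := D) (u' := η') (v' := D')
      (fun t ht' => hη t (by rwa [uIcc_of_le ht] at ht'))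
      (fun t ht' => hDd t (by rwa [uIcc_of_le ht] at ht')) (hII hη'c) (hII hD'c)
    rw [h, hη₁, hη₂]
    ring
  -- `η Q = η D' + η D (4 coth + H)/4` pointwise, hence for the integrals
  have hsplit : ∫ t in t₁..t₂, η t * Q t =
      ∫ t in t₁..t₂, (-(η' t * D t) + η t * (D t * (4 * coth t + H t) / 4)) := by
    have h1 : ∫ t in t₁..t₂, η t * Q t =
        ∫ t in t₁..t₂, (η t * D' t + η t * (D t * (4 * coth t + H t) / 4)) := by
      refine intervalIntegral.integral_congr fun t _ => ?_
      simp only [hD']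
      ring
    have hi1 : IntervalIntegrable (fun t => η t * D' t) volume t₁ t₂ := hII (hηc.mul hD'c)
    have hi2 : IntervalIntegrable (fun t => η t * (D t * (4 * coth t + H t) / 4)) volume t₁ t₂ :=
      hII (hηc.mul ((hDc.mul ((continuousOn_const.mul hcothc).add hHc)).div_const 4))
    have hi3 : IntervalIntegrable (fun t => -(η' t * D t)) volume t₁ t₂ := (hII (hη'c.mul hDc)).neg
    rw [h1, intervalIntegral.integral_add hi1 hi2, intervalIntegral.integral_add hi3 hi2,
      hparts, intervalIntegral.integral_neg]
  -- pointwise bound of the new integrand by `(C + 2 coth t₁) D`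
  have hpt : ∀ t ∈ Icc t₁ t₂,
      -(η' t * D t) + η t * (D t * (4 * coth t + H t) / 4) ≤ (C + 2 * coth t₁) * D t := by
    intro t ht'
    have hDnn : 0 ≤ D t := by
      have := hBG t ht'
      simp only [hD, hH, hcoth]
      linarith
    have hcotht : coth t ≤ coth t₁ := coth_le_coth ht₁ ht'.1
    have hcoth₁ : 0 < coth t₁ := div_pos (Real.cosh_pos t₁) (Real.sinh_pos_iff.2 ht₁)
    have hHle : H t ≤ 4 * coth t := hBG t ht'
    have h0 := hη0 t ht'
    have h1 := hη1 t ht'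
    have hC' := hC t ht'
    have hA : -(η' t * D t) ≤ C * D t := by
      have : -η' t ≤ C := (neg_le_abs (η' t)).trans hC'
      nlinarith
    have hB : η t * (D t * (4 * coth t + H t) / 4) ≤ 2 * coth t₁ * D t := by
      rcases le_or_gt 0 (4 * coth t + H t) with ha | ha
      · have h2 : η t * (D t * (4 * coth t + H t) / 4) ≤ D t * (4 * coth t + H t) / 4 := by
          have : 0 ≤ D t * (4 * coth t + H t) / 4 := by positivity
          nlinarith
        have h3 : D t * (4 * coth t + H t) / 4 ≤ 2 * coth t * D t := by nlinarith
        have h4 : 2 * coth t * D t ≤ 2 * coth t₁ * D t := by nlinarith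
        linarith
      · have h2 : η t * (D t * (4 * coth t + H t) / 4) ≤ 0 := by
          have : D t * (4 * coth t + H t) / 4 ≤ 0 := by
            have := mul_nonpos_iff.2 (Or.inl ⟨hDnn, ha.le⟩)
            linarith
          nlinarith
        nlinarith
    linarith
  -- integrate the pointwise bound
  have hmono : ∫ t in t₁..t₂, (-(η' t * D t) + η t * (D t * (4 * coth t + H t) / 4)) ≤
      ∫ t in t₁..t₂, (C + 2 * coth t₁) * D t := by
    refine intervalIntegral.integral_mono_on ht ?_ ?_ hpt
    · exact (hII (hη'c.mul hDc)).neg.add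
        (hII (hηc.mul ((hDc.mul ((continuousOn_const.mul hcothc).add hHc)).div_const 4)))
    · exact hII (continuousOn_const.mul hDc)
  rw [intervalIntegral.integral_const_mul] at hmono
  calc ∫ t in t₁..t₂, η t * Q t
      = ∫ t in t₁..t₂, (-(η' t * D t) + η t * (D t * (4 * coth t + H t) / 4)) := hsplit
    _ ≤ (C + 2 * coth t₁) * ∫ t in t₁..t₂, D t := hmono

end Summit.SmoothPoincare4.SmoothPoincare4.Cruxes.YamabePinchedEinsteinBulk.Sketch

end
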